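import Mathlib
import Summits.ValiantsHypothesis.ValiantsHypothesis.Theses.FifoMatching
import Summits.ValiantsHypothesis.ValiantsHypothesis.Theorems.FifoMatchingNNDivisionHardTorusHomogeneous
import Summits.ValiantsHypothesis.ValiantsHypothesis.Theorems.FifoMatchingNNDivisionHardShadowDominated
import Literature.Computability.AlgebraicComplexity.NestFreeMatchingPoly
import HarnessLib

/-!
# Route FifoMatching — crux `NNDivisionHard` (stmt-ValiantsHypothesis-21181):
# ONE residual of record — cheap ∧ TORUS-HOMOGENEOUS ∧ window-dense ∧ deep ∧ spread ∧ undominated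

Three partial residuals of 21181 are in the tree, each an `↔` with the route decl BY NAME:
`TorusHomogeneous.nnDivisionHard_iff_torusTier` (✓ p817386: cheap ∧ torus-homogeneous ∧ hyper-degree),
`Residual.nnDivisionHard_iff_spreadDenseDeepResidual` (✓ p822526: cheap ∧ window-dense ∧ deep ∧ spread) and
`ShadowDominated.nnDivisionHard_iff_undominatedResidual` (✓ p823553: … ∧ undominated).  Intersecting residual
classes is NOT automatic (each `↔` may rest on a different reduction), so this file proves the intersection:

* `nnDivisionHard_iff_grandResidual` — `Theses.FifoMatching.NNDivisionHard` ⟺ for all `k c`, eventually in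
  `n`, every nonzero cofactor `h` that is CHEAP (`L₊(h) ≤ 2^((log₂ n + c)^c)`), TORUS-HOMOGENEOUS (one
  vertex-degree vector for all monomials), WINDOW-DENSE (every monomial meets every window of
  `2·((log₂ n + c)^c + log₂ n + 1)^6 + 12` consecutive vertices), DEEP (no homogeneous component of degree
  `≤ 2^((log₂ n + k)^k)`), SPREAD (every monomial uses `> (log₂ n + k)^k` distinct arcs) and UNDOMINATED
  (for every `T` of `≤ (log₂ n + k)^k` arcs some arc set carries a `T`-freed nest-free perfect matching but
  no `T`-freed monomial support of `h`) satisfies `2^((log₂ n + c)^c) < L₊(NN_n · h) + L₊(h)`.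

Why the intersection is sound: the torus normalisation `h ↦ top_{vertexWeight} h` (✓
`TorusHomogeneous.complexity_topVertexComponent_le`: certificate cost does not increase; `NN_n` is
torus-homogeneous) only SHRINKS the support (`support_topComponent_subset`), and the four other residual
properties are inherited by sub-supported cofactors (`windowDense_of_support_subset`, `deep_of_support_subset`,
`spread_of_support_subset`, `undominated_of_support_subset`), while cheapness follows from
`L₊(top h) ≤ L₊(h)`.

Simplest explicit member of the grand residual known to this file's author (not formalised): `h = NC_n^D`
with `D > 2^⌊n^{1/8}⌋` (`NC_n` the noncrossing = LIFO matching polynomial, monotone-cheap): cheap by repeated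
squaring, torus-homogeneous (`δ ≡ D`), window-dense, deep, spread, and undominated (a crossing nest-free
perfect matching carries no noncrossing one); deciding it amounts to a monotone lower bound for the Boolean
function «`A` carries a nest-free AND a noncrossing perfect matching».

Honest framing: residual book-keeping BY NAME (one enemy class instead of three); `NNDivisionHard`, `NNNotVP`
and `VP ≠ VNP` stay OPEN (NOT proved).  No definitions, no named facts.
-/

noncomputable section

-- Sub = Summit single-conjunct layout: the duplicated namespace component is mandated by the tree.
set_option linter.dupNamespace false
set_option autoImplicit false

namespace Summit.ValiantsHypothesis.ValiantsHypothesis.Theorems.FifoMatching.NNDivisionHard.GrandResidual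

open MvPolynomial Finset Literature.Computability.AlgebraicComplexity
open scoped NNReal BigOperators Classical
open Summit.ValiantsHypothesis.ValiantsHypothesis.Theorems.ZeroOneTransfer.Negative
  (topComponent support_topComponent_subset topComponent_ne_zero)
open Summit.ValiantsHypothesis.ValiantsHypothesis.Theorems.FifoMatching.NNLowDegreeCofactorHard
  (vertexWeight vertexDeg)
open Summit.ValiantsHypothesis.ValiantsHypothesis.Theorems.FifoMatching.NNDivisionHard.TorusHomogeneous
  (vertexDeg_eq_of_mem_topComponent complexity_topVertexComponent_le)
open Summit.ValiantsHypothesis.ValiantsHypothesis.Theorems.FifoMatching.NNNotVP.DivisionSplit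
  (σ NN SuppFn freeVars suppFn_freeVars_iff)
open Summit.ValiantsHypothesis.ValiantsHypothesis.Theorems.FifoMatching.NNDivisionHard.ShadowDominated
  (nnDivisionHard_iff_undominatedResidual)

/-! ### §1 Residual properties pass to sub-supported cofactors -/

variable {n : ℕ} {h h' : MvPolynomial (Fin (2 * n) × Fin (2 * n)) ℝ≥0}

/-- Window-density is inherited by sub-supported cofactors. [folklore] -/
theorem windowDense_of_support_subset (hsub : h'.support ⊆ h.support) (G : ℕ)
    (hdense : ∀ d ∈ h.support, ∀ s : ℕ, s + G ≤ 2 * n →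
      ∃ e ∈ d.support, (s ≤ e.1.val ∧ e.1.val < s + G) ∨ (s ≤ e.2.val ∧ e.2.val < s + G)) :
    ∀ d ∈ h'.support, ∀ s : ℕ, s + G ≤ 2 * n →
      ∃ e ∈ d.support, (s ≤ e.1.val ∧ e.1.val < s + G) ∨ (s ≤ e.2.val ∧ e.2.val < s + G) :=
  fun d hd s hs => hdense d (hsub hd) s hs

/-- Depth (vanishing of all low homogeneous components) is inherited by sub-supported cofactors.
[folklore] -/
theorem deep_of_support_subset (hsub : h'.support ⊆ h.support) (E : ℕ)
    (hdeep : ∀ e : ℕ, e ≤ E → homogeneousComponent e h = 0) :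
    ∀ e : ℕ, e ≤ E → homogeneousComponent e h' = 0 := by
  intro e he
  refine homogeneousComponent_eq_zero' e h' fun d hd hdeg => ?_
  have hcoeff : coeff d (homogeneousComponent e h) = coeff d h := by
    rw [coeff_homogeneousComponent, if_pos hdeg]
  rw [hdeep e he, coeff_zero] at hcoeff
  exact (mem_support_iff.1 (hsub hd)) hcoeff.symm

/-- Spread is inherited by sub-supported cofactors. [folklore] -/
theorem spread_of_support_subset (hsub : h'.support ⊆ h.support) (K : ℕ)
    (hspread : ∀ d ∈ h.support, K < d.support.card) :
    ∀ d ∈ h'.support, K < d.support.card :=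
  fun d hd => hspread d (hsub hd)

/-- The shadow is monotone in the support. [folklore] -/
theorem suppFn_of_support_subset (hsub : h'.support ⊆ h.support) {A : Finset (σ n)}
    (hA : SuppFn h' A) : SuppFn h A := by
  obtain ⟨m, hm, hmA⟩ := hA
  exact ⟨m, hsub hm, hmA⟩

/-- Undominatedness is inherited by sub-supported cofactors (a smaller support is dominated less).
[folklore] -/
theorem undominated_of_support_subset (hsub : h'.support ⊆ h.support) (K : ℕ)
    (hund : ∀ T : Finset (σ n), T.card ≤ K →
      ∃ A : Finset (σ n), SuppFn (freeVars T (NN n)) A ∧ ¬ SuppFn (freeVars T h) A) :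
    ∀ T : Finset (σ n), T.card ≤ K →
      ∃ A : Finset (σ n), SuppFn (freeVars T (NN n)) A ∧ ¬ SuppFn (freeVars T h') A := by
  intro T hT
  obtain ⟨A, hA, hnot⟩ := hund T hT
  refine ⟨A, hA, fun h'A => hnot ?_⟩
  rw [suppFn_freeVars_iff] at h'A ⊢
  exact suppFn_of_support_subset hsub h'A

/-! ### §2 The grand residual -/

/-- ★ **`NNDivisionHard` ⟺ its CHEAP ∧ TORUS-HOMOGENEOUS ∧ WINDOW-DENSE ∧ DEEP ∧ SPREAD ∧ UNDOMINATED
tier** (one residual enemy class of record for stmt-21181, BY NAME).  `⇒` is trivial; `⇐`: by the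
undominated residual (`nnDivisionHard_iff_undominatedResidual`) it suffices to treat cheap, window-dense,
deep, spread, undominated `h ≠ 0`; its top vertex-potential component `h'` is torus-homogeneous
(`vertexDeg_eq_of_mem_topComponent`), nonzero, no costlier as a certificate
(`complexity_topVertexComponent_le`) and sub-supported, hence inherits the other five properties (§1).
[folklore] -/
theorem nnDivisionHard_iff_grandResidual :
    Summit.ValiantsHypothesis.ValiantsHypothesis.Theses.FifoMatching.NNDivisionHard ↔
      ∀ k c : ℕ, ∃ n₀ : ℕ, ∀ n ≥ n₀, ∀ h : MvPolynomial (Fin (2 * n) × Fin (2 * n)) ℝ≥0, h ≠ 0 →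
        complexity h ≤ 2 ^ ((Nat.log 2 n + c) ^ c) →
        (∀ d ∈ h.support, ∀ d' ∈ h.support, vertexDeg d = vertexDeg d') →
        (∀ d ∈ h.support, ∀ s : ℕ,
          s + (2 * ((Nat.log 2 n + c) ^ c + Nat.log 2 n + 1) ^ 6 + 12) ≤ 2 * n →
          ∃ e ∈ d.support,
            (s ≤ e.1.val ∧ e.1.val < s + (2 * ((Nat.log 2 n + c) ^ c + Nat.log 2 n + 1) ^ 6 + 12)) ∨
            (s ≤ e.2.val ∧ e.2.val < s + (2 * ((Nat.log 2 n + c) ^ c + Nat.log 2 n + 1) ^ 6 + 12))) →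
        (∀ e : ℕ, e ≤ 2 ^ ((Nat.log 2 n + k) ^ k) → homogeneousComponent e h = 0) →
        (∀ d ∈ h.support, (Nat.log 2 n + k) ^ k < d.support.card) →
        (∀ T : Finset (σ n), T.card ≤ (Nat.log 2 n + k) ^ k →
          ∃ A : Finset (σ n), SuppFn (freeVars T (NN n)) A ∧ ¬ SuppFn (freeVars T h) A) →
        2 ^ ((Nat.log 2 n + c) ^ c) <
          complexity (nestFreeMatchingPoly n ℝ≥0 * h) + complexity h := by
  constructor
  · intro H k c
    obtain ⟨n₀, hn₀⟩ := H c
    exact ⟨n₀, fun n hn h hh _ _ _ _ _ _ => hn₀ n hn h hh⟩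
  · intro H
    refine nnDivisionHard_iff_undominatedResidual.mpr fun k c => ?_
    obtain ⟨n₀, hn₀⟩ := H k c
    refine ⟨n₀, fun n hn h hh hcheap hdense hdeep hspread hund => ?_⟩
    -- the torus normalisation of the cofactor
    set B : ℕ := 2 * h.totalDegree + 1 with hB
    set h' : MvPolynomial (Fin (2 * n) × Fin (2 * n)) ℝ≥0 := topComponent (vertexWeight B) h with hh'
    have hne : h' ≠ 0 := topComponent_ne_zero _ hh
    have hsub : h'.support ⊆ h.support := support_topComponent_subset _ h
    obtain ⟨hc1, hc2⟩ := complexity_topVertexComponent_le n B h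
    have htor : ∀ d ∈ h'.support, ∀ d' ∈ h'.support, vertexDeg d = vertexDeg d' :=
      fun d hd d' hd' => vertexDeg_eq_of_mem_topComponent h hd hd'
    have hlt := hn₀ n hn h' hne (hc2.trans hcheap) htor
      (windowDense_of_support_subset hsub _ hdense) (deep_of_support_subset hsub _ hdeep)
      (spread_of_support_subset hsub _ hspread) (undominated_of_support_subset hsub _ hund)
    calc 2 ^ ((Nat.log 2 n + c) ^ c)
        < complexity (nestFreeMatchingPoly n ℝ≥0 * h') + complexity h' := hlt
      _ ≤ complexity (nestFreeMatchingPoly n ℝ≥0 * h) + complexity h := Nat.add_le_add hc1 hc2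

/-- **What the parent crux `NNNotVP` (stmt-11615) hinges on, BY NAME, after the grand residual**: the
0/1 transfer (`Theses.DivisionGap.ZeroOneTransfer`, stmt-5066 — only its instance at `NN` is consumed,
`NNNotVP.TransferAtNN`) and the grand residual give the crux (landed glue `NNNotVPSplit.nnNotVP_of_subs`).
Both hypotheses are OPEN. [folklore] -/
theorem nnNotVP_of_zeroOneTransfer_of_grandResidual
    (hZ : Summit.ValiantsHypothesis.ValiantsHypothesis.Theses.DivisionGap.ZeroOneTransfer)
    (hR : ∀ k c : ℕ, ∃ n₀ : ℕ, ∀ n ≥ n₀, ∀ h : MvPolynomial (Fin (2 * n) × Fin (2 * n)) ℝ≥0, h ≠ 0 →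
        complexity h ≤ 2 ^ ((Nat.log 2 n + c) ^ c) →
        (∀ d ∈ h.support, ∀ d' ∈ h.support, vertexDeg d = vertexDeg d') →
        (∀ d ∈ h.support, ∀ s : ℕ,
          s + (2 * ((Nat.log 2 n + c) ^ c + Nat.log 2 n + 1) ^ 6 + 12) ≤ 2 * n →
          ∃ e ∈ d.support,
            (s ≤ e.1.val ∧ e.1.val < s + (2 * ((Nat.log 2 n + c) ^ c + Nat.log 2 n + 1) ^ 6 + 12)) ∨
            (s ≤ e.2.val ∧ e.2.val < s + (2 * ((Nat.log 2 n + c) ^ c + Nat.log 2 n + 1) ^ 6 + 12))) →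
        (∀ e : ℕ, e ≤ 2 ^ ((Nat.log 2 n + k) ^ k) → homogeneousComponent e h = 0) →
        (∀ d ∈ h.support, (Nat.log 2 n + k) ^ k < d.support.card) →
        (∀ T : Finset (σ n), T.card ≤ (Nat.log 2 n + k) ^ k →
          ∃ A : Finset (σ n), SuppFn (freeVars T (NN n)) A ∧ ¬ SuppFn (freeVars T h) A) →
        2 ^ ((Nat.log 2 n + c) ^ c) <
          complexity (nestFreeMatchingPoly n ℝ≥0 * h) + complexity h) :
    Summit.ValiantsHypothesis.ValiantsHypothesis.Theses.FifoMatching.NNNotVP :=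
  Summit.ValiantsHypothesis.ValiantsHypothesis.Theorems.FifoMatching.NNNotVPSplit.nnNotVP_of_zeroOneTransfer hZ
    (nnDivisionHard_iff_grandResidual.mpr hR)

end Summit.ValiantsHypothesis.ValiantsHypothesis.Theorems.FifoMatching.NNDivisionHard.GrandResidual

end
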